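import Literature.AlgebraicGeometry.RelativeSpec.EquivariantModuleDescent
import Literature.AlgebraicGeometry.Modules.PullbackReflectsIsoOfFlatSurjective
import HarnessLib

/-!
# Galois descent of quasi-coherent modules along a free finite quotient: uniqueness

Sequel to `RelativeSpec/EquivariantModuleDescent` (existence: a quasi-coherent `E` on `X` with a
`G`-equivariant structure `φ` is `p^* F` for the quasi-coherent `F = (p_* E)^G` on the affine
geometric quotient `Q = X/G` of a free action). Here: **the descended module is unique** — any two
quasi-coherent `F₁, F₂` on `Q` with isomorphisms `eᵢ : p^* Fᵢ ≅ E` compatible with `φ` are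
isomorphic over `E` (`ActionOver.descent_unique_of_free`), for `p` moreover flat (automatic for the
tree's quotient `toQuotient` of a free action, `RelativeSpec/FreeQuotient.flat_toQuotient`).
Mechanism (Greither, LNM 1534, Ch. 0 Prop. 7.2 — descent of morphisms; [MFK94] Prop. 7.1):
the adjunct `F' ⟶ p_* E` of a compatible `e' : p^* F' ⟶ E` is `G`-invariant
(`homEquiv_comp_pushforwardAct_eq`), hence factors through `j : F' ⟶ (p_* E)^G` with
`p^* j ≫ descentHom = e'` (`exists_hom_moduleInvariants_fac`); `p^* j` is then an isomorphism,
and so is `j`, because **pull-back along the flat surjective `p` reflects isomorphisms**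
(`Modules/PullbackReflectsIsoOfFlatSurjective`). Everything is proved; no named facts.

## References

* [Greither1992CyclicGalois] C. Greither, LNM 1534 (1992), Ch. 0 Thm. 7.1, Prop. 7.2 (pp. 28–29).
* [MumfordFogartyKirwan1994] D. Mumford, J. Fogarty, F. Kirwan, *GIT*, 3rd ed., Prop. 7.1.
* [MumfordAV1970] D. Mumford, *Abelian Varieties* (1970), §12 Thm. 1 (p. 112).
-/

noncomputable section

-- `TopCat.Presheaf`/`Scheme.Modules` are not reducible (as in Mathlib's `AlgebraicGeometry/Modules`).
set_option backward.isDefEq.respectTransparency false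

universe u

open CategoryTheory Limits AlgebraicGeometry TopologicalSpace Opposite
open Literature.AlgebraicGeometry.Modules

namespace Literature.AlgebraicGeometry.RelativeSpec.ActionOver

/-! ### Uniqueness of the descended module -/

section Unique

variable {X Q : Scheme.{u}} {p : X ⟶ Q} {G : Type u} [Group G] (ρ : ActionOver p G)
variable (E : X.Modules) (φ : ∀ g : G, (Scheme.Modules.pullback (ρ.aut g).hom).obj E ≅ E)
variable [Fintype G]

omit [Fintype G] in
/-- **A compatible trivialisation lands in the invariants.** If `e' : p^* F' ⟶ E` intertwines the
canonical equivariant structure of the pull-back with `φ`, then its adjunct `F' ⟶ p_* E` is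
`G`-invariant: `θ ≫ (g · –) = θ` — on a section `x` of `F'`, `g · e'(η_p x) = φ_g(η_{ρ.aut g}(e'(η_p x)))
= ((ρ.aut g)^* e' ≫ φ_g)(η η x) = (can ≫ e')(η η x) = e'(η_p x)` up to transport.
[cite: Greither1992CyclicGalois, Ch. 0 Prop. 7.2 (p. 29)] -/
theorem homEquiv_comp_pushforwardAct_eq (F' : Q.Modules)
    (e' : (Scheme.Modules.pullback p).obj F' ⟶ E)
    (he' : ∀ g : G, (Scheme.Modules.pullback (ρ.aut g).hom).map e' ≫ (φ g).hom =
      ((Scheme.Modules.pullbackComp (ρ.aut g).hom p).app F' ≪≫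
        (Scheme.Modules.pullbackCongr (ρ.aut_comp g)).app F').hom ≫ e') (g : G) :
    (Scheme.Modules.pullbackPushforwardAdjunction p).homEquiv F' E e' ≫ ρ.pushforwardAct E φ g =
      (Scheme.Modules.pullbackPushforwardAdjunction p).homEquiv F' E e' := by
  refine Scheme.Modules.hom_ext _ _ fun V => ?_
  ext x
  rw [Scheme.Modules.Hom.comp_app, CategoryTheory.comp_apply,
    Literature.AlgebraicGeometry.HodgeTheory.pullbackObj_homEquiv_app]
  change ρ.actSections E φ g V (e'.app (p ⁻¹ᵁ V) (unitSection p F' V x)) =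
    e'.app (p ⁻¹ᵁ V) (unitSection p F' V x)
  rw [actSections_eq, ← pullback_map_app_unitSection]
  have hc : (φ g).hom.app ((ρ.aut g).hom ⁻¹ᵁ (p ⁻¹ᵁ V))
      (((Scheme.Modules.pullback (ρ.aut g).hom).map e').app ((ρ.aut g).hom ⁻¹ᵁ (p ⁻¹ᵁ V))
        (unitSection (ρ.aut g).hom ((Scheme.Modules.pullback p).obj F') (p ⁻¹ᵁ V)
          (unitSection p F' V x))) =
      ((Scheme.Modules.pullback (ρ.aut g).hom).map e' ≫ (φ g).hom).app
        ((ρ.aut g).hom ⁻¹ᵁ (p ⁻¹ᵁ V))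
        (unitSection (ρ.aut g).hom ((Scheme.Modules.pullback p).obj F') (p ⁻¹ᵁ V)
          (unitSection p F' V x)) := rfl
  rw [hc, he' g]
  change E.presheaf.map (eqToHom (ρ.preimage_preimage g V).symm).op
      (e'.app _ (((Scheme.Modules.pullbackCongr (ρ.aut_comp g)).hom.app F').app _
        (((Scheme.Modules.pullbackComp (ρ.aut g).hom p).hom.app F').app _
          (unitSection (ρ.aut g).hom _ (p ⁻¹ᵁ V) (unitSection p F' V x))))) =
    e'.app (p ⁻¹ᵁ V) (unitSection p F' V x)
  rw [pullbackComp_hom_app_unitSection]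
  have hcg : ((Scheme.Modules.pullbackCongr (ρ.aut_comp g)).hom.app F').app
        ((ρ.aut g).hom ⁻¹ᵁ (p ⁻¹ᵁ V)) (unitSection ((ρ.aut g).hom ≫ p) F' V x) =
      ((Scheme.Modules.pullback p).obj F').presheaf.map
        (eqToHom (ρ.preimage_preimage g V)).op (unitSection p F' V x) :=
    pullbackCongr_hom_app_unitSection F' (ρ.aut_comp g) V x
  rw [hcg, app_presheaf_map]
  exact (presheaf_map_map_congr E _ _ (𝟙 _) _).trans (presheaf_map_self E _ _)

/-- **The comparison with the invariants induced by a compatible trivialisation.** For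
`e' : p^* F' ≅ E` compatible with `φ`, the adjunct of `e'.hom` factors through
`j : F' ⟶ (p_* E)^G` with `p^* j ≫ descentHom = e'.hom`; `p^* j` is therefore an isomorphism
as soon as `descentHom` is. [cite: Greither1992CyclicGalois, Ch. 0 Prop. 7.2 (p. 29)] -/
theorem exists_hom_moduleInvariants_fac (F' : Q.Modules)
    (e' : (Scheme.Modules.pullback p).obj F' ⟶ E)
    (he' : ∀ g : G, (Scheme.Modules.pullback (ρ.aut g).hom).map e' ≫ (φ g).hom =
      ((Scheme.Modules.pullbackComp (ρ.aut g).hom p).app F' ≪≫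
        (Scheme.Modules.pullbackCongr (ρ.aut_comp g)).app F').hom ≫ e') :
    ∃ j : F' ⟶ ρ.moduleInvariants E φ,
      (Scheme.Modules.pullback p).map j ≫ ρ.descentHom E φ = e' := by
  set θ := (Scheme.Modules.pullbackPushforwardAdjunction p).homEquiv F' E e' with hθ
  have hθ0 : θ ≫ ρ.invariantsDefect E φ = 0 := by
    refine Limits.Pi.hom_ext _ _ fun g => ?_
    rw [Category.assoc, invariantsDefect, Limits.Pi.lift_π, zero_comp, Preadditive.comp_sub,
      Category.comp_id, ρ.homEquiv_comp_pushforwardAct_eq E φ F' e' he' g, sub_self]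
  refine ⟨kernel.lift (ρ.invariantsDefect E φ) θ hθ0, ?_⟩
  rw [descentHom, ← Adjunction.homEquiv_naturality_left_symm]
  change ((Scheme.Modules.pullbackPushforwardAdjunction p).homEquiv F' E).symm
      (kernel.lift (ρ.invariantsDefect E φ) θ hθ0 ≫ kernel.ι (ρ.invariantsDefect E φ)) = e'
  rw [kernel.lift_ι, hθ, Equiv.symm_apply_apply]

/-- **(T2) Galois descent of quasi-coherent modules along a free finite quotient — UNIQUENESS.**
For an affine, flat geometric quotient `p : X ⟶ Q` by a free action and `E` with an equivariant
structure `φ`, two quasi-coherent `F₁, F₂` on `Q` with isomorphisms `eᵢ : p^* Fᵢ ≅ E` compatible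
with `φ` are isomorphic over `E`: both compare isomorphically with `(p_* E)^G`
(`exists_hom_moduleInvariants_fac` + `isIso_descentHom`, and `p^*` reflects isomorphisms for the
flat surjective `p`, `Modules.isIso_of_isIso_pullback_map`). (Greither Ch. 0 Prop. 7.2: descended
morphisms are unique; [MFK94] Prop. 7.1: `p^*` is an equivalence onto descent data; Mumford AV
§12 Thm. 1.) [cite: Greither1992CyclicGalois, Ch. 0 Prop. 7.2 (p. 29)] -/
theorem descent_unique_of_free [IsAffineHom p] [Flat p] (hq : ρ.IsGeometricQuotient p)
    (hfree : ∀ (V : Q.Opens), IsAffineOpen V → ∀ g : G, g ≠ 1 →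
      Ideal.span (Set.range fun b : Γ(X, p ⁻¹ᵁ V) ↦ ρ.act g V b - b) = ⊤)
    [E.IsQuasicoherent]
    (hunit : (φ 1).hom = ((Scheme.Modules.pullbackCongr ρ.aut_one_hom).app E).hom ≫
      ((Scheme.Modules.pullbackId X).app E).hom)
    (hcocycle : ∀ g h : G, (φ (g * h)).hom =
      ((Scheme.Modules.pullbackCongr (ρ.aut_mul_hom g h)).app E).hom ≫
        ((Scheme.Modules.pullbackComp (ρ.aut h).hom (ρ.aut g).hom).app E).inv ≫
          (Scheme.Modules.pullback (ρ.aut h).hom).map (φ g).hom ≫ (φ h).hom)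
    (F₁ F₂ : Q.Modules) (e₁ : (Scheme.Modules.pullback p).obj F₁ ≅ E)
    (e₂ : (Scheme.Modules.pullback p).obj F₂ ≅ E)
    (he₁ : ∀ g : G, (Scheme.Modules.pullback (ρ.aut g).hom).map e₁.hom ≫ (φ g).hom =
      ((Scheme.Modules.pullbackComp (ρ.aut g).hom p).app F₁ ≪≫
        (Scheme.Modules.pullbackCongr (ρ.aut_comp g)).app F₁).hom ≫ e₁.hom)
    (he₂ : ∀ g : G, (Scheme.Modules.pullback (ρ.aut g).hom).map e₂.hom ≫ (φ g).hom =
      ((Scheme.Modules.pullbackComp (ρ.aut g).hom p).app F₂ ≪≫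
        (Scheme.Modules.pullbackCongr (ρ.aut_comp g)).app F₂).hom ≫ e₂.hom) :
    ∃ i : F₁ ≅ F₂, (Scheme.Modules.pullback p).map i.hom ≫ e₂.hom = e₁.hom := by
  have hE : IsAffineLocalizing E := IsAffineLocalizing.of_isQuasicoherent E
  haveI : Surjective p := ⟨hq.surjective⟩
  haveI := ρ.isIso_descentHom E φ hq hfree hE hunit hcocycle
  obtain ⟨j₁, hj₁⟩ := ρ.exists_hom_moduleInvariants_fac E φ F₁ e₁.hom he₁
  obtain ⟨j₂, hj₂⟩ := ρ.exists_hom_moduleInvariants_fac E φ F₂ e₂.hom he₂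
  haveI : IsIso ((Scheme.Modules.pullback p).map j₁) := IsIso.of_isIso_fac_right hj₁
  haveI : IsIso ((Scheme.Modules.pullback p).map j₂) := IsIso.of_isIso_fac_right hj₂
  haveI : IsIso j₁ := isIso_of_isIso_pullback_map p j₁
  haveI : IsIso j₂ := isIso_of_isIso_pullback_map p j₂
  refine ⟨asIso j₁ ≪≫ (asIso j₂).symm, ?_⟩
  have h2 : (Scheme.Modules.pullback p).map (inv j₂) ≫ e₂.hom = ρ.descentHom E φ := by
    rw [← hj₂, Functor.map_inv, IsIso.inv_hom_id_assoc]
  rw [Iso.trans_hom, asIso_hom, Iso.symm_hom, asIso_inv, Functor.map_comp, Category.assoc, h2,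
    hj₁]

end Unique

end Literature.AlgebraicGeometry.RelativeSpec.ActionOver
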